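import Summits.QuantumFields.YangMills.Theorems.UnitScaleTiltProp8FlatPortProp27PadL0
import Literature.MathematicalPhysics.QuantumFieldTheory.Balaban1983to89.B6QGQCoerciveKLevelV1L3
import Literature.MathematicalPhysics.QuantumFieldTheory.Balaban1983to89.B6PadLevelV1L3
import HarnessLib

/-!
# Route `UnitScaleTilt`, crux K1 child «MinimiserStabilityRegPr» (stmt-QuantumFields-19200), v8 pillar **P2 `stub_flatOpsCubeSeq`** — THE PORT BRIDGE, file 6,
# **EVERY ODD `L ≥ 3`**: [Balaban1984PropagatorsII] PROPOSITION 2.7 (2.149) — THE ENTRIES OF `(QGQ*)⁻¹` — AT k LEVELS FOR EVERY TORUS FAMILY, `k ≥ 1`, WITHOUT THE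
# PLACEMENT HYPOTHESIS AND **WITHOUT THE BLOCK-SIZE FLOOR `4 ≤ ℓ`** — the twin of ✓`UnitScaleTiltProp8FlatPortProp27PadL0.prop27_kLevel_pad` obtained by reading
# lit-balaban's RE-CENTRED-WINDOW lineage `…V1L3` (sub-row G-F3′-L0∕L3: `B6QGQCoerciveKLevelV1L3.prop27_kLevel_unconditional`, binder `4 ≤ ℓ` DROPPED, coercivity
# constant `γ₀ = (1/12)²/C_E` of the L3 dominance, placement predicate `PlacedC`; `B6PadLevelV1L3.placed_pad`) instead of the level-0 lineage `…V1L0`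

Cell `ym3-torus` (HUMAN RULING D-0037, YM ladder rung R3), seat `ym-inputs-p09` (cell `pub/ym-inputs`, on-call hand; ★★OWNER RULING g26-№20 L-FLOOR LEDGER, item LF-1 ∕
(P2-L3)).  `--supports stmt-QuantumFields-19200 --as helper`; count-neutral; def-free.

WHAT IS PROVED (sorry-free; axioms standard; no definition): **`prop27_kLevel_pad_allL`** = ✓`FlatPortProp27PadL0.prop27_kLevel_pad` with the binder `(_ : 4 ≤ ℓ)`
DELETED and the coercivity constant read from the L3 file (`B6QGQCoerciveKLevelV1L3.gam0 d ℓ b₁ = (1/12)²/C_E(d, L, b₁)` in place of the L0 file's `(1/8)²/C_E`): binder list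
`(1 ≤ k, k + 1 ≤ m + K, P′ = L·P″, P″ ≥ 5, M_h = Lᵃ ≥ 8, R ≥ 2L², M₂ ≤ L·M_h, N₁ + 1 ≤ R·L·M_h, band)`, constants `σ₁, A′, M₂, c, N₁` of the L3 export, conclusion
`|⟪e_i, (QGQ*)⁻¹e_{i′}⟫| ≤ Λ_i⁻¹Λ_{i′}⁻¹·(2/γ₀)·e^{−δ₄·d_T(β i, β i′)}` for the genuine `(QGQ*)⁻¹ = EE (domT hN D hk)`.  Proof = the L0 proof verbatim (pad by one empty level,
`B6PadLevelV1L3.placed_pad`; transport back with `UI_single`∕`EE_UI`∕`beta_pad`∕`lam_pad`∕`dist_eT`, all consumed BY NAME).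
HONEST SCOPE: bookkeeping over landed certificates (lit-balaban's L3 chain, p38's padding); inherits `M_h = Lᵃ ≥ 8`, `R ≥ 2L²`, the band, `M₂ ≤ L·M_h`,
`N₁ + 1 ≤ R·L·M_h`; nothing here proves `stub_halvingStep` or the crux; YM₃ on T³ = rung R3, NOT the Clay problem, no mass-gap claim.

References: T. Bałaban, CMP **96** (1984) 223–250 [Balaban1984PropagatorsII] Prop. 2.7 (2.147)–(2.149) p.248–249, (2.1)–(2.4) p.224.
-/

set_option autoImplicit false

noncomputable section

open scoped BigOperators InnerProductSpace

namespace Summit.QuantumFields.YangMills.Theorems.FlatPortProp27PadAllL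

open Literature.MathematicalPhysics.QuantumFieldTheory.Balaban1983to89
open B6MultiLevelBoxOperator (N0)
open B6MultiLevelTorusOperatorL0 (TDomains)
open B6Geom246MultiLevelTorusL0 (geomT)
open B6GlobalChartV1 (PV)
open B6GlobalChartV1L0 (domT)
open B6Ineq2142KLevelV1L0 (β)
open B6Prop27KLevelV1L0 (lam)
open B6SectAOperatorsV1 (BondIdx)
open B6SectAVectorModelV1 (EE)
open B6RandomWalk (delta3)
open B6QGQCoerciveKLevelV1L3 (gam0 prop27_kLevel_unconditional)
open B6CubeWindowV1 (GlobalBand)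
open B6PadLevelV1 (hN_pad)
open B6PadLevelV1L0 (padT sameOm_domT_pad dist_eT globalBand_pad)
open B6PadLevelV1L3 (placed_pad)
open FlatPortCor28Pad (UI_single EE_UI)
open FlatPortCor28PadL0 (beta_pad)
open FlatPortProp27PadL0 (lam_pad)

variable {d ℓ m K : ℕ} {hd : 1 ≤ d + 1} {hL : Odd (ℓ + 1) ∧ 1 < ℓ + 1}
variable {Mh k R : ℕ} {P' P'' : Fin (d + 1) → ℕ}

/-- **[B6] PROPOSITION 2.7 (2.149) AT k LEVELS, EVERY ODD `L ≥ 3`, `k ≥ 1`, NO PLACEMENT HYPOTHESIS, NO BLOCK-SIZE FLOOR**: the binders of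
`B6QGQCoerciveKLevelV1L3.prop27_kLevel_unconditional` with `(2 ≤ k, P′ ≥ 5, PlacedC)` replaced by `(1 ≤ k, k + 1 ≤ m + K, P′ = L·P″, P″ ≥ 5)`; same constants
`σ₁, A′, M₂, c, N₁`, same entry bound for `(QGQ*)⁻¹` of `domT hN D hk` with the L3 coercivity constant `γ₀ = (1/12)²/C_E`; = ✓`FlatPortProp27PadL0.prop27_kLevel_pad` with the
binder `(4 ≤ ℓ)` deleted. [cite: Balaban1984PropagatorsII, Prop. 2.7 (2.147)–(2.149) p.248–249, (2.1)–(2.4) p.224] -/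
theorem prop27_kLevel_pad_allL (d ℓ : ℕ) (hd : 1 ≤ d + 1) (hL : Odd (ℓ + 1) ∧ 1 < ℓ + 1) {b₀ b₁ : ℝ} (hb₀ : 0 < b₀) (hb₁ : b₀ ≤ b₁) :
    ∃ σ₁ : ℝ, 0 < σ₁ ∧ ∀ (σ : ℝ), 0 < σ → σ ≤ σ₁ → ∀ (α : ℝ), 0 < α → α < 1 →
    ∃ (A' M₂ c : ℝ) (N₁ : ℕ), 0 < A' ∧ 0 < M₂ ∧ 0 ≤ c ∧
    ∀ (m K : ℕ) {Mh k R : ℕ} {P' : Fin (d + 1) → ℕ}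
      (hN : ∀ μ, N0 ℓ Mh k P' μ = (PV d ℓ m K hd hL).sitesPerDir 0) (D : TDomains d ℓ Mh k P' R) (hk : k ≤ m + K) (_ : 1 ≤ k) (_ : k + 1 ≤ m + K)
      {P'' : Fin (d + 1) → ℕ} (_ : ∀ μ, P' μ = (ℓ + 1) * P'' μ) (_ : ∀ μ, 5 ≤ P'' μ)
      {a : ℕ} (_ : Mh = (ℓ + 1) ^ a) (_ : 8 ≤ Mh) (_ : 2 * (ℓ + 1) ^ 2 ≤ R)
      (_ : M₂ ≤ ((ℓ : ℝ) + 1) * Mh) (_ : N₁ + 1 ≤ R * ((ℓ + 1) * Mh))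
      {cf : ℝ} (hcf : cf ≠ 0) {w : BondIdx (B6GlobalChartV1L0.domT hN D hk) → ℝ} (hw : ∀ i, 0 < w i) (_ : GlobalBand b₀ b₁ cf w),
      ∀ i i' : BondIdx (domT hN D hk),
        |⟪EuclideanSpace.single i (1 : ℝ), EE (domT hN D hk) hcf hw (EuclideanSpace.single i' (1 : ℝ))⟫_ℝ| ≤
          (lam hN D hk cf i)⁻¹ * (lam hN D hk cf i')⁻¹ * (2 / gam0 d ℓ b₁ *
            Real.exp (-(min (delta3 α (2 * σ) / 4) (gam0 d ℓ b₁ / A' / (2 * (1 * (4 / delta3 α (2 * σ)) * (2 * ((d : ℝ) + 1) * c)) + 1)) *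
              (geomT D).dist (β hN D hk i) (β hN D hk i')))) := by
  obtain ⟨σ₁, hσ₁, h⟩ := prop27_kLevel_unconditional d ℓ hd hL hb₀ hb₁
  refine ⟨σ₁, hσ₁, fun σ hσ hσ1 α hα hα1 => ?_⟩
  obtain ⟨A', M₂, c, N₁, hA', hM₂, hc, hmain⟩ := h σ hσ hσ1 α hα hα1
  refine ⟨A', M₂, c, N₁, hA', hM₂, hc, ?_⟩
  intro m K Mh k R P' hN D hk _hk1 hk' P'' hLP hP5 a hMha hM8 hR2 hM hRM cf hcf w hw hwb i i'
  have hS := sameOm_domT_pad hN D hk hLP hk'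
  have hw' : ∀ j, 0 < (w ∘ hS.idxB) j := fun j => hw _
  have key := hmain m K (hN_pad hN hLP) (padT D hLP) hk' (by omega) hMha hM8 hR2 hP5 (placed_pad D hLP hP5) hM hRM hcf hw'
    (globalBand_pad D hLP hN hk hk' hwb) (hS.idxB.symm i) (hS.idxB.symm i')
  rw [UI_single hS i, UI_single hS i', EE_UI hS hcf hw hw', hS.UI.inner_map_map, lam_pad hN D hk hLP hk' cf i, lam_pad hN D hk hLP hk' cf i',
    beta_pad hN D hk hLP hk' i, beta_pad hN D hk hLP hk' i', dist_eT] at key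
  exact key

end Summit.QuantumFields.YangMills.Theorems.FlatPortProp27PadAllL

end
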